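import Summits.ValiantsHypothesis.ValiantsHypothesis.Theorems.FifoMatchingNNDivisionHardExposedFibreMcCormick
import HarnessLib

/-!
# Located faces beyond `C₀^β`, part 3: `MET^{COR}_{n+1}` — blind in the `C₀^β`-chamber, DECIDED from the pentagonal chamber

Theorems-side PORT, part 3 of 3, of `Cruxes/NNDivisionHard/ExposedFibre.lean` REV 3 @3c757fe0c4bc (sha16 fd9e507b00b36db6; author
val-idea-40 g3; critic of record val-idea-crit-9 g1 VERDICT #30: P-P2e PAID, `#print axioms metLocatedDecided_holds` = std; VERDICT
#29: `metFaceBlockConst_holds`) — texts VERBATIM, namespace `…Cruxes.NNDivisionHard.ExposedFibre40` ↦ `…Theorems.FifoMatching.ExposedFibre`;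
see part 1 (`…ExposedFibreRung`) for the port conventions.  THIS MODULE: §3 the metric body `MET_{n+1}` in covariance coordinates
(`metCor`), §3a the contraction lemma `met_contract` and the FIXED-POINT phenomenon ★ `metFaceBlockConst_holds` (δ-unfolded)
(the whole `C₀^β`-face of `MET` lies in `W_β`: no `C₀^β`-perturbative located certificate sees `MET`), §3b the PENTAGONAL certificate
`pentagonal_le` / `pentagonal_eq` (a Farkas combination of ten triangle inequalities; equality forces the anti-cut), and §3c
★ `metLocatedDecided_holds` (the workfile's `MetLocatedDecided`, δ-unfolded; definition-free port, see part 1): for every block map with a section and blocks of size `≥ 2`,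
`HasEFOfSize (COR(K_n) + MET^{COR}_{n+1}) r → 3^m ≤ (r+1)·2^m` — ONE exact cut with the pentagonal sum `c₁ = Σ_{s≠t} P_σ` (valid on
`COR(K_n)`, vanishing on `W_β`, `≤ 1/3` per configuration on `MET` with the read forced), `funLeft_image_of_between`, PROP A with one
passenger point; with the pairing: `xc(COR(K_n) + MET^{COR}_{n+1}) + 1 ≥ 1.5^{⌊n/2⌋}`.  The statement-only items `MetFixedPoint`,
`ContractionClosed`, `MetContractionClosed`, `MetExposedFibreBlind` stay in the workfile.
Credit: val-idea-40 g3 (W5-P2); the enemy `MET` was recorded by val-idea-41 (W5-R1, AR1/AR2).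
HONEST FRAMING: helper rows for an OPEN crux; stmt-21181 `NNDivisionHard` OPEN; COR-VIRTUAL OPEN; `VP ≠ VNP` NOT proved; nothing
here is a summit statement.
-/

set_option autoImplicit false

-- the mandated summit-side namespace repeats a component by design (single-problem summit)
set_option linter.dupNamespace false

noncomputable section

open Matrix Finset
open scoped Pointwise

namespace Summit.ValiantsHypothesis.ValiantsHypothesis.Theorems.FifoMatching.ExposedFibre

open Literature.Barriers.PneNP (HasEFOfSize)
open Literature.Combinatorics.Optimization (corPolytopeGraph corVec)
open Summit.ValiantsHypothesis.ValiantsHypothesis.Theorems.FifoMatching.LocatedFaceExposure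
open Summit.ValiantsHypothesis.ValiantsHypothesis.Theorems.FifoMatching.XcDivision

variable {n m : ℕ}

/-! ## §3 `MET`: fixed point of the `C₀^β`-chamber, killed from the pentagonal chamber

`MET_{n+1}` in covariance coordinates (`x_{0p} = Y_pp`, `x_pq = Y_pp + Y_qq − 2Y_pq`): the rooted triangles are the
McCormick inequalities, the unrooted ones read `Y_pr + Y_qr − Y_pq ≤ Y_rr` and `Y_pp + Y_qq + Y_rr − Y_pq − Y_pr − Y_qr ≤ 1`.

### §3a  the `C₀^β`-chamber is blind (fixed point)
On the `C₀^β`-face (`Y_pq = Y_pp` within blocks, i.e. `x_pq = 0`; note `C₀^β = −Σ_{same block} x_pq`) the triangle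
inequalities force `x_pr = x_qr` (`met_contract`): the face is ENTIRELY block-constant (⊆ `W_β`) and reads onto
`MET^{COR}_{m+1}` (`MetFixedPoint`).  So every direction `C₀^β + εd`, `d ⊥ W_β`, has the whole `MET_{m+1}`-face as
fibre, and every `C₀^β`-first located certificate (E, E♯, the landed engine's reads, their compositions with a scale-`m`
certificate `X`) is exactly as strong on `MET` as `X` one scale down — monotone-only.  Same for `Z_full`
(38 `TowerContractionRung`, `P = ⊤`) and `COR` (`funLeft_image_cor_blockFace`): `ContractionClosed` species.

### §3b  the pentagonal chamber bites
Split every block (size ≥ 2) into a-type and b-type points (both nonempty).  A CONFIGURATION is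
`(root; a ∈ B_s^a, b ∈ B_s^b; a' ∈ B_t^a, b' ∈ B_t^b)`, `s ≠ t`, with signs `σ = −1` on `a, a'` and `+1` on `root, b, b'`;
its pentagonal functional `P_σ(x) = Σ_{i<j} σ_iσ_j x_ij` satisfies `P_σ(δ(S)) = s_S(1 − s_S) ≤ 0` on cuts, `= 0` on every
union of blocks (`s_S = 0`: one `+` and one `−` per block) — so `P_σ ⊥ W_β` and `c₁ := Σ_config P_σ` is valid on `COR(K_n)`
with `c₁`-face `⊇ F_β` —, while on `MET` (`pentagonal_le`, `pentagonal_eq`): `P_σ ≤ 2/3` with equality iff the restriction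
to the configuration is the anti-cut `⅔𝟙 − ⅓δ({a,a'})`.  The point `y_A := ⅔𝟙 − ⅓δ(a-type points)` maximises every
configuration at once, so `face_{c₁}(MET)` = {all configured pairs pinned; only same-type twins free}, and the second cut
`C₀^β = −Σ_{same block} x_pq` pins the twins to distance `0`: `face_{C₀^β}(face_{c₁}(COR + MET)) = F_β + {x*}`.  Two exact
cuts (`face_add_face₁` twice), read, FMPTdW: `3^m ≤ (r+1)·2^m` (`MetLocatedDecided`); equivalently `MET ∈ E♭` with the
admissible direction `c₁ + ε C₀^β` (`MetExposedFibreBlind`).  With the pairing `β` (`m = ⌊n/2⌋`):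
`xc(COR(K_n) + MET^{COR}_{n+1}) + 1 ≥ 1.5^{⌊n/2⌋}` — no anchoring (41 AR1/AR2), no KMR. -/

/-- the metric body `MET_{n+1}` in `COR` coordinates. -/
def metCor (n : ℕ) : Set (Fin n × Fin n → ℝ) :=
  mcCormick n ∩ {Y | ∀ p q r, p ≠ q → q ≠ r → p ≠ r →
    Y (p, r) + Y (q, r) - Y (p, q) ≤ Y (r, r) ∧ Y (p, p) + Y (q, q) + Y (r, r) - Y (p, q) - Y (p, r) - Y (q, r) ≤ 1}

/-- **contraction lemma** (§3a): on the `C₀^β`-face of `MET` (`x_pq = 0`, i.e. `Y_pq = Y_pp = Y_qq`) rows `p`, `q` agree. -/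
theorem met_contract {Y : Fin n × Fin n → ℝ} (hY : Y ∈ metCor n) {p q : Fin n} (hpq : p ≠ q)
    (h₁ : Y (p, q) = Y (p, p)) (h₂ : Y (p, q) = Y (q, q)) (r : Fin n) : Y (p, r) = Y (q, r) := by
  obtain ⟨hM, hT⟩ := hY
  have hsym := hM.1
  by_cases hpr : p = r
  · subst hpr; rw [hsym q p, h₁]
  by_cases hqr : q = r
  · subst hqr; exact h₂
  have t₁ := (hT p r q hpr (Ne.symm hqr) hpq).1
  have t₂ := (hT q r p hqr (Ne.symm hpr) (Ne.symm hpq)).1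
  rw [hsym r q] at t₁
  rw [hsym q p, hsym r p] at t₂
  linarith

/-- §3a in kernel: the `C₀^β`-face of `MET` lies inside `W_β` (symmetric and `β`-block-constant). -/
theorem metFaceBlockConst_holds :
    ∀ (n m : ℕ) (β : Fin n → Fin m), ∀ Y ∈ metCor n, (∀ p q, β p = β q → Y (p, q) = Y (p, p)) →
      (∀ p p', Y (p, p') = Y (p', p)) ∧ ∀ p p' p'' p''', β p = β p'' → β p' = β p''' → Y (p, p') = Y (p'', p''') := by
  intro n m β Y hY hface
  have hsym : ∀ p q, Y (p, q) = Y (q, p) := hY.1.1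
  -- rows of two points of one block agree
  have hrow : ∀ p p₂, β p = β p₂ → ∀ r, Y (p, r) = Y (p₂, r) := by
    intro p p₂ hpp r
    by_cases hne : p = p₂
    · rw [hne]
    · have h₁ : Y (p, p₂) = Y (p, p) := hface p p₂ hpp
      have h₂ : Y (p, p₂) = Y (p₂, p₂) := by rw [hsym p p₂, hface p₂ p hpp.symm]
      exact met_contract hY hne h₁ h₂ r
  refine ⟨hsym, fun p p₁ p₂ p₃ hp hp₁ => ?_⟩
  rw [hrow p p₂ hp p₁, hsym p₂ p₁, hrow p₁ p₃ hp₁ p₂, hsym p₃ p₂]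

/-- ★ **PENTAGONAL CERTIFICATE on `MET`** (§3b, proved): for distinct non-root points `i j` (signs `+`) and `k l`
(signs `−`; the root is the third `+`), `½·P_σ = Y_ik + Y_il + Y_jk + Y_jl − Y_ij − Y_kl − Y_kk − Y_ll ≤ ⅓` on `MET` —
Farkas certificate `⅓·perimeter(root,i,j) + ⅓·Σ (nine triangle inequalities)`. -/
theorem pentagonal_le {Y : Fin n × Fin n → ℝ} (hY : Y ∈ metCor n) {i j k l : Fin n}
    (hij : i ≠ j) (hik : i ≠ k) (hil : i ≠ l) (hjk : j ≠ k) (hjl : j ≠ l) (hkl : k ≠ l) :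
    Y (i, k) + Y (i, l) + Y (j, k) + Y (j, l) - Y (i, j) - Y (k, l) - Y (k, k) - Y (l, l) ≤ 1 / 3 := by
  obtain ⟨⟨hsym, hdiag, hM⟩, hT⟩ := hY
  have e1 := (hM i j hij).2.2          -- perimeter (root,i,j):  Y ii + Y jj - 1 ≤ Y ij
  have e2 := (hM k l hkl).1            -- x_kl ≤ x_0k + x_0l :   0 ≤ Y kl
  have e3 := (hT k l i hkl (Ne.symm hil) (Ne.symm hik)).1   -- x_kl ≤ x_ik + x_il
  have e4 := (hT k l j hkl (Ne.symm hjl) (Ne.symm hjk)).1   -- x_kl ≤ x_jk + x_jl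
  have e5 := (hT i j k hij hjk hik).1                       -- x_ij ≤ x_ik + x_jk
  have e6 := (hT i j l hij hjl hil).1                       -- x_ij ≤ x_il + x_jl
  have e7 := (hM k i (Ne.symm hik)).2.1   -- x_0i ≤ x_0k + x_ik :  Y ki ≤ Y kk
  have e8 := (hM l i (Ne.symm hil)).2.1
  have e9 := (hM k j (Ne.symm hjk)).2.1
  have e10 := (hM l j (Ne.symm hjl)).2.1
  rw [hsym k i] at e3 e7; rw [hsym l i] at e3 e8; rw [hsym k j] at e4 e9; rw [hsym l j] at e4 e10
  linarith

/-- ★ … with EQUALITY only at the anti-cut `⅔𝟙 − ⅓δ({k,l})` restricted to the configuration (§3b, proved): the pentagonal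
direction exposes ONE point of `MET₅`. -/
theorem pentagonal_eq {Y : Fin n × Fin n → ℝ} (hY : Y ∈ metCor n) {i j k l : Fin n}
    (hij : i ≠ j) (hik : i ≠ k) (hil : i ≠ l) (hjk : j ≠ k) (hjl : j ≠ l) (hkl : k ≠ l)
    (h : Y (i, k) + Y (i, l) + Y (j, k) + Y (j, l) - Y (i, j) - Y (k, l) - Y (k, k) - Y (l, l) = 1 / 3) :
    Y (i, i) = 2 / 3 ∧ Y (j, j) = 2 / 3 ∧ Y (k, k) = 1 / 3 ∧ Y (l, l) = 1 / 3 ∧ Y (i, j) = 1 / 3 ∧ Y (k, l) = 0 ∧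
      Y (i, k) = 1 / 3 ∧ Y (i, l) = 1 / 3 ∧ Y (j, k) = 1 / 3 ∧ Y (j, l) = 1 / 3 := by
  obtain ⟨⟨hsym, hdiag, hM⟩, hT⟩ := hY
  have e1 := (hM i j hij).2.2
  have e2 := (hM k l hkl).1
  have e3 := (hT k l i hkl (Ne.symm hil) (Ne.symm hik)).1
  have e4 := (hT k l j hkl (Ne.symm hjl) (Ne.symm hjk)).1
  have e5 := (hT i j k hij hjk hik).1
  have e6 := (hT i j l hij hjl hil).1
  have e7 := (hM k i (Ne.symm hik)).2.1
  have e8 := (hM l i (Ne.symm hil)).2.1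
  have e9 := (hM k j (Ne.symm hjk)).2.1
  have e10 := (hM l j (Ne.symm hjl)).2.1
  rw [hsym k i] at e3 e7; rw [hsym l i] at e3 e8; rw [hsym k j] at e4 e9; rw [hsym l j] at e4 e10
  refine ⟨?_, ?_, ?_, ?_, ?_, ?_, ?_, ?_, ?_, ?_⟩ <;> linarith

/-! ### §3c `MetLocatedDecided` — PROVED (critic price P-P2e, `MET` half): ONE exact cut with the pentagonal sum
`c₁ = Σ_{s≠t} P_{(τ s, τ t; ρ s, ρ t)}` — valid on `COR(K_n)` (`P(δ_S) = s_S(1−s_S)/2 ≤ 0`), vanishing on `W_β`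
(`blockConstSym_of_mem_span`), `≤ 1/3` per configuration on `MET` (`pentagonal_le`) with the anti-cut read forced
(`pentagonal_eq`) — and the observation that ANY face of `COR(K_n)` between `F_β` and `COR(K_n)` reads onto `COR(K_m)`
(`funLeft_image_of_between`): the second cut of §3b is not needed.  PROP A with one passenger point. -/


open Classical in
/-- ★ **`MET` is DECIDED by its located face** — `xc(COR(K_n) + MET^{COR}_{n+1}) + 1 ≥ 1.5^m` for every `β` with
blocks of size `≥ 2` (`m = ⌊n/2⌋` with the pairing): no anchoring, no KMR; the recorded «MET fixed point» holds for the
`C₀^β`-chamber only. -/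
theorem metLocatedDecided_holds :
    ∀ (n m : ℕ) (β : Fin n → Fin m) (ρ : Fin m → Fin n), (∀ t, β (ρ t) = t) →
      (∀ s, 2 ≤ (univ.filter fun p => β p = s).card) → ∀ r : ℕ,
        HasEFOfSize (corPolytopeGraph (⊤ : SimpleGraph (Fin n)) + metCor n) r → 3 ^ m ≤ (r + 1) * 2 ^ m := by
  intro n m β ρ hρ hblk r hEF
  rcases Nat.lt_or_ge m 2 with hm | hm
  · interval_cases m
    · simp
    · rcases r with _ | r
      · exfalso
        have h0M : (0 : Fin n × Fin n → ℝ) ∈ metCor n :=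
          ⟨⟨fun _ _ => rfl, fun _ => ⟨le_rfl, zero_le_one⟩, fun _ _ _ => ⟨le_rfl, le_rfl, by simp⟩⟩,
            fun _ _ _ _ _ _ => ⟨by simp, by simp⟩⟩
        exact not_hasEFOfSize_zero_cor_add (ρ 0) h0M (fun Y hY => (hY.1.2.1 (ρ 0)).1) hEF
      · rw [pow_one, pow_one]
        omega
  -- main case `m ≥ 2`
  obtain ⟨B, hB⟩ := exists_blockDir β
  have hτex : ∀ s : Fin m, ∃ p, β p = s ∧ p ≠ ρ s := by
    intro s
    obtain ⟨p₁, hp₁, p₂, hp₂, hne⟩ := Finset.one_lt_card.1 (hblk s)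
    by_cases h : p₁ = ρ s
    · exact ⟨p₂, (Finset.mem_filter.1 hp₂).2, fun h' => hne (h.trans h'.symm)⟩
    · exact ⟨p₁, (Finset.mem_filter.1 hp₁).2, h⟩
  choose τ hτβ hτne using hτex
  have hne : ∀ s t : Fin m, s ≠ t → ρ s ≠ ρ t ∧ ρ s ≠ τ t ∧ τ s ≠ ρ t ∧ τ s ≠ τ t := fun s t hst =>
    ⟨fun h => hst (by rw [← hρ s, h, hρ t]), fun h => hst (by rw [← hρ s, h, hτβ t]),
      fun h => hst (by rw [← hτβ s, h, hρ t]), fun h => hst (by rw [← hτβ s, h, hτβ t])⟩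
  -- the pentagonal sum `c₁`
  obtain ⟨Pv, hPv⟩ : ∃ Pv : Fin m → Fin m → (Fin n × Fin n → ℝ), ∀ s t x, Pv s t ⬝ᵥ x =
      x (τ s, ρ s) + x (τ s, ρ t) + x (τ t, ρ s) + x (τ t, ρ t) - x (τ s, τ t) - x (ρ s, ρ t) -
        x (ρ s, ρ s) - x (ρ t, ρ t) := by
    refine ⟨fun s t => Pi.single (τ s, ρ s) 1 + Pi.single (τ s, ρ t) 1 + Pi.single (τ t, ρ s) 1 +
      Pi.single (τ t, ρ t) 1 - Pi.single (τ s, τ t) 1 - Pi.single (ρ s, ρ t) 1 - Pi.single (ρ s, ρ s) 1 -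
      Pi.single (ρ t, ρ t) 1, fun s t x => ?_⟩
    simp only [add_dotProduct, sub_dotProduct, single_dotProduct, one_mul]
  obtain ⟨c₁, hc₁⟩ : ∃ c₁ : Fin n × Fin n → ℝ, ∀ x, c₁ ⬝ᵥ x = ∑ s, ∑ t, if s = t then (0 : ℝ) else
      x (τ s, ρ s) + x (τ s, ρ t) + x (τ t, ρ s) + x (τ t, ρ t) - x (τ s, τ t) - x (ρ s, ρ t) -
        x (ρ s, ρ s) - x (ρ t, ρ t) := by
    refine ⟨∑ s, ∑ t, if s = t then 0 else Pv s t, fun x => ?_⟩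
    rw [sum_dotProduct]
    refine Finset.sum_congr rfl fun s _ => ?_
    rw [sum_dotProduct]
    refine Finset.sum_congr rfl fun t _ => ?_
    split_ifs
    · exact zero_dotProduct x
    · exact hPv s t x
  -- valid on `COR(K_n)` with maximum `0`
  have hCv : ∀ b : Fin n → Bool, c₁ ⬝ᵥ corVec (⊤ : SimpleGraph (Fin n)) b ≤ 0 := by
    intro b
    rw [hc₁]
    refine Finset.sum_nonpos fun s _ => Finset.sum_nonpos fun t _ => ?_
    split_ifs
    · exact le_rfl
    · simp only [corVec_top_apply]
      cases b (τ s) <;> cases b (τ t) <;> cases b (ρ s) <;> cases b (ρ t) <;> norm_num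
  have hC : ∀ x ∈ corPolytopeGraph (⊤ : SimpleGraph (Fin n)), c₁ ⬝ᵥ x ≤ 0 :=
    dot_le_of_mem_convexHull _ _ _ (by rintro _ ⟨b, rfl⟩; exact hCv b)
  -- vanishes on `W_β`
  have hW : ∀ w ∈ Submodule.span ℝ (Set.range fun b : {b : Fin n → Bool // ∀ p q, β p = β q → b p = b q} =>
      corVec (⊤ : SimpleGraph (Fin n)) b.1), c₁ ⬝ᵥ w = 0 := by
    intro w hw
    obtain ⟨hws, hwb⟩ := blockConstSym_of_mem_span β hw
    rw [hc₁]
    refine Finset.sum_eq_zero fun s _ => Finset.sum_eq_zero fun t _ => ?_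
    split_ifs
    · rfl
    · rw [hwb (τ s) (ρ s) (ρ s) (ρ s) (by rw [hτβ, hρ]) rfl,
        hwb (τ s) (ρ t) (ρ s) (ρ t) (by rw [hτβ, hρ]) rfl,
        hwb (τ t) (ρ s) (ρ t) (ρ s) (by rw [hτβ, hρ]) rfl, hws (ρ t) (ρ s),
        hwb (τ t) (ρ t) (ρ t) (ρ t) (by rw [hτβ, hρ]) rfl,
        hwb (τ s) (τ t) (ρ s) (ρ t) (by rw [hτβ, hρ]) (by rw [hτβ, hρ])]
      ring
  -- valid on `MET` with maximum `Σ 1/3`, the equality case reads onto one point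
  have hMle : ∀ Y ∈ metCor n, ∀ s t, s ≠ t →
      Y (τ s, ρ s) + Y (τ s, ρ t) + Y (τ t, ρ s) + Y (τ t, ρ t) - Y (τ s, τ t) - Y (ρ s, ρ t) -
        Y (ρ s, ρ s) - Y (ρ t, ρ t) ≤ 1 / 3 := fun Y hY s t hst => by
    obtain ⟨h1, h2, h3, h4⟩ := hne s t hst
    exact pentagonal_le hY (i := τ s) (j := τ t) (k := ρ s) (l := ρ t) h4 (hτne s) h3 h2.symm (hτne t) h1
  have hM : ∀ Y ∈ metCor n, c₁ ⬝ᵥ Y ≤ ∑ s : Fin m, ∑ t : Fin m, (if s = t then (0 : ℝ) else 1 / 3) := by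
    intro Y hY
    rw [hc₁]
    refine Finset.sum_le_sum fun s _ => Finset.sum_le_sum fun t _ => ?_
    split_ifs with hst
    · exact le_rfl
    · exact hMle Y hY s t hst
  have hpt : ∀ Y ∈ metCor n, c₁ ⬝ᵥ Y = ∑ s : Fin m, ∑ t : Fin m, (if s = t then (0 : ℝ) else 1 / 3) →
      ∀ s t, Y (ρ s, ρ t) = if s = t then (1 / 3 : ℝ) else 0 := by
    intro Y hY hface
    rw [hc₁] at hface
    have hle : ∀ s ∈ (Finset.univ : Finset (Fin m)), ∀ t ∈ (Finset.univ : Finset (Fin m)),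
        (if s = t then (0 : ℝ) else Y (τ s, ρ s) + Y (τ s, ρ t) + Y (τ t, ρ s) + Y (τ t, ρ t) - Y (τ s, τ t) -
          Y (ρ s, ρ t) - Y (ρ s, ρ s) - Y (ρ t, ρ t)) ≤ (if s = t then (0 : ℝ) else 1 / 3) := by
      intro s _ t _
      split_ifs with hst
      · exact le_rfl
      · exact hMle Y hY s t hst
    have hrow := (Finset.sum_eq_sum_iff_of_le fun s hs => Finset.sum_le_sum (hle s hs)).1 hface
    have hcell : ∀ s t, s ≠ t → Y (ρ s, ρ s) = 1 / 3 ∧ Y (ρ s, ρ t) = 0 := by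
      intro s t hst
      have h := (Finset.sum_eq_sum_iff_of_le (hle s (Finset.mem_univ _))).1 (hrow s (Finset.mem_univ _)) t
        (Finset.mem_univ _)
      rw [if_neg hst, if_neg hst] at h
      obtain ⟨h1, h2, h3, h4⟩ := hne s t hst
      have hq := pentagonal_eq hY (i := τ s) (j := τ t) (k := ρ s) (l := ρ t) h4 (hτne s) h3 h2.symm (hτne t) h1 h
      exact ⟨hq.2.2.1, hq.2.2.2.2.2.1⟩
    intro s t
    split_ifs with hst
    · subst hst
      obtain ⟨t', ht'⟩ := Fintype.exists_ne_of_one_lt_card (by rw [Fintype.card_fin]; omega) s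
      exact (hcell s t' (Ne.symm ht')).1
    · exact (hcell s t hst).2
  -- the anti-cut witness `Y_A = ⅔𝟙 − ⅓δ(leaders)`
  obtain ⟨ℓ, hℓ⟩ : ∃ ℓ : Fin n → Bool, ∀ p, ℓ p = decide (p = ρ (β p)) := ⟨_, fun _ => rfl⟩
  have hℓρ : ∀ s, ℓ (ρ s) = true := fun s => by rw [hℓ, hρ]; simp
  have hℓτ : ∀ s, ℓ (τ s) = false := fun s => by rw [hℓ, hτβ]; simp [hτne s]
  obtain ⟨YA, hYA⟩ : ∃ YA : Fin n × Fin n → ℝ, ∀ p q, YA (p, q) =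
      if p = q then (if ℓ p then 1 / 3 else 2 / 3) else (if ℓ p ∧ ℓ q then 0 else 1 / 3) :=
    ⟨fun pq => if pq.1 = pq.2 then (if ℓ pq.1 then 1 / 3 else 2 / 3) else (if ℓ pq.1 ∧ ℓ pq.2 then 0 else 1 / 3),
      fun _ _ => rfl⟩
  have hYAM : YA ∈ metCor n := by
    refine ⟨⟨fun p q => ?_, fun p => ?_, fun p q hpq => ?_⟩, fun p q r' hpq hqr hpr => ?_⟩
    · rw [hYA, hYA]
      by_cases h : p = q
      · subst h
        rfl
      · rw [if_neg h, if_neg (Ne.symm h)]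
        cases ℓ p <;> cases ℓ q <;> simp
    · rw [hYA, if_pos rfl]
      cases ℓ p <;> simp <;> norm_num
    · rw [hYA p q, hYA p p, hYA q q, if_neg hpq, if_pos rfl, if_pos rfl]
      cases ℓ p <;> cases ℓ q <;> simp <;> norm_num
    · rw [hYA p r', hYA q r', hYA p q, hYA r' r', hYA p p, hYA q q, if_neg hpr, if_neg hqr, if_neg hpq,
        if_pos rfl, if_pos rfl, if_pos rfl]
      cases ℓ p <;> cases ℓ q <;> cases ℓ r' <;> simp <;> norm_num
  have hYAc : c₁ ⬝ᵥ YA = ∑ s : Fin m, ∑ t : Fin m, (if s = t then (0 : ℝ) else 1 / 3) := by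
    rw [hc₁]
    refine Finset.sum_congr rfl fun s _ => Finset.sum_congr rfl fun t _ => ?_
    split_ifs with hst
    · rfl
    · obtain ⟨h1, h2, h3, h4⟩ := hne s t hst
      rw [hYA (τ s) (ρ s), hYA (τ s) (ρ t), hYA (τ t) (ρ s), hYA (τ t) (ρ t), hYA (τ s) (τ t), hYA (ρ s) (ρ t),
        hYA (ρ s) (ρ s), hYA (ρ t) (ρ t), if_neg (hτne s), if_neg h3, if_neg (Ne.symm h2), if_neg (hτne t),
        if_neg h4, if_neg h1, if_pos rfl, if_pos rfl]
      norm_num [hℓρ, hℓτ]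
  have hLYA : LinearMap.funLeft ℝ ℝ (fun ij : Fin m × Fin m => (ρ ij.1, ρ ij.2)) YA =
      fun st => if st.1 = st.2 then (1 / 3 : ℝ) else 0 := by
    funext st
    obtain ⟨s, t⟩ := st
    rw [LinearMap.funLeft_apply]
    show YA (ρ s, ρ t) = if s = t then 1 / 3 else 0
    rw [hYA]
    by_cases hst : s = t
    · subst hst
      simp [hℓρ]
    · rw [if_neg (hne s t hst).1, if_neg hst]
      simp [hℓρ]
  -- assemble: one cut, read, PROP A with one passenger point
  have h1 := hEF.face_add_face₁ c₁ 0 _ hC hM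
  have h2 := h1.image_linearMap (LinearMap.funLeft ℝ ℝ (fun ij : Fin m × Fin m => (ρ ij.1, ρ ij.2)))
  have hG : corPolytopeGraph (⊤ : SimpleGraph (Fin n)) ∩ {x | B ⬝ᵥ x = 0} ⊆
      corPolytopeGraph (⊤ : SimpleGraph (Fin n)) ∩ {x | c₁ ⬝ᵥ x = 0} :=
    fun x hx => ⟨hx.1, dot_eq_zero_on_face β hB hW x hx⟩
  rw [Set.image_add, funLeft_image_of_between β hB hρ hG Set.inter_subset_left] at h2
  have himg : LinearMap.funLeft ℝ ℝ (fun ij : Fin m × Fin m => (ρ ij.1, ρ ij.2)) ''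
      (metCor n ∩ {Y | c₁ ⬝ᵥ Y = ∑ s : Fin m, ∑ t : Fin m, (if s = t then (0 : ℝ) else 1 / 3)}) =
      convexHull ℝ (Set.range fun _ : Fin 1 => (fun st : Fin m × Fin m => if st.1 = st.2 then (1 / 3 : ℝ) else 0)) := by
    rw [Set.range_const, convexHull_singleton]
    apply Set.Subset.antisymm
    · rintro _ ⟨Y, ⟨hY, hface⟩, rfl⟩
      refine Set.mem_singleton_iff.2 (funext fun st => ?_)
      rw [LinearMap.funLeft_apply]
      exact hpt Y hY hface st.1 st.2
    · intro z hz
      rw [Set.mem_singleton_iff.1 hz]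
      exact ⟨YA, ⟨hYAM, hYAc⟩, hLYA⟩
  rw [himg] at h2
  have h4 := corPolytopeGraph_top_add_hull_three_pow_le _ (by norm_num) h2
  simpa using h4

end Summit.ValiantsHypothesis.ValiantsHypothesis.Theorems.FifoMatching.ExposedFibre

end
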